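import Summits.Ventures.Crystal3D.Theorems.StickyWulffConstantNoReconstructionGainOffRegistryDegenerate
import Summits.Ventures.Crystal3D.Theorems.StickyWulffConstantNoReconstructionGainCellFluxIsolated
import Mathlib.Analysis.SpecialFunctions.Complex.Arg
import HarnessLib

/-!
# A rung of the atom for every normal: films whose off-lattice part is COPLANAR (any plane)

HONEST FRAMING. Part of the venture `Summits/Ventures/Crystal3D` (cell `crystal3d-full`), helper
`--supports` the crux `NoReconstructionGain` (stmt-Ventures-19144, route
`route-Ventures-StickyWulffConstant`), line `adhesion`.  An UNCONDITIONAL rung of the registered atom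
`stub_adhesion`, for EVERY facet normal `ν`, with `R = 1` and NO rim defect (`C = 0`):

`coplanarOffLattice_adhesion` — let `X ⊇ P` be a finite unit packing around the `ν`-slab sample `P` of
`Λ₀ = fccStacking 1 √(2/3)`, and suppose the OFF-LATTICE film balls `{x ∈ X \ P : x ∉ Λ₀}` all lie in ONE
affine plane — ANY plane: an adlayer in a wrong registry, an incommensurate or rotated monolayer raft (the
contact layer of a foreign grain), a tilted two-dimensional island; the registry part of the film (lattice
continuation, steps, kinks, adatoms at sites) is arbitrary.  Then `#cross(P, X \ P) ≤ contactDeficiency (X \ P)`.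
So NO MONOLAYER (coplanar) off-lattice reconstruction of any fcc facet gains.  More generally
(`planarComponents_adhesion`): the same when the off-lattice balls carry plane labels, constant along
off-lattice contacts, each ball lying in its plane (several islands on different terraces / at different
tilts, not touching one another).

The new geometric input is planar: **a finite set of points in a plane with pairwise distances `≥ 1` has
a point with at most three points at distance exactly `1`** (`exists_card_partners_le_three_of_coplanar`:
the lexicographically lowest point sees its partners in a half-open half-plane, where four directions
pairwise `≥ 60°` apart do not fit — `card_le_three_of_halfOpen`).  Hence a coplanar off-lattice part is
contact-3-degenerate, and the lineage's R26 rung `offRegistryThreeDegenerate_adhesion` (p523683: L3′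
off-lattice balls touch `≤ 3` lattice balls ⇒ plug-relative 6-degeneracy ⇒ peeling certificate ⇒ registry
stacking ⇒ telescoping) applies.

WHAT THIS IS NOT: the atom for off-lattice parts that are genuinely three-dimensional (multilayer foreign
grains, amorphous films); rung F-C1 not moved.
-/

noncomputable section

namespace Summit.Ventures.Crystal3D.Theorems

open Summit.Ventures.Crystal3D Finset Real
open Literature.MathematicalPhysics.StatisticalMechanics (fccStacking orderedContacts contactDeficiency)
open scoped InnerProductSpace

/-! ### Four directions pairwise `≥ 60°` apart do not fit in a half-open half-plane -/

/-- Four angles `0 ≤ t₀ < t₁ < t₂ < t₃ < π` whose pairwise differences have cosine `≤ 1/2` do not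
exist (consecutive gaps are `≥ π/3`, so `t₃ − t₀ ≥ π`). -/
theorem four_sorted_angles_false (t : Fin 4 → ℝ) (hmono : StrictMono t) (hlo : 0 ≤ t 0) (hhi : t 3 < π)
    (hC : ∀ i j, i ≠ j → cos (t i - t j) ≤ 1 / 2) : False := by
  have hgap : ∀ i j : Fin 4, i < j → π / 3 ≤ t j - t i := by
    intro i j hij
    have hpos : 0 < t j - t i := sub_pos.2 (hmono hij)
    by_contra h
    push Not at h
    have hle : t j - t i ≤ π := by
      have := hmono.monotone (Fin.zero_le i)
      have := hmono.monotone (Fin.le_last j)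
      simp only [Fin.last] at this
      linarith
    have h1 : cos (π / 3) < cos (t j - t i) := cos_lt_cos_of_nonneg_of_le_pi hpos.le (by linarith) h
    rw [cos_pi_div_three] at h1
    have h2 := hC j i (ne_of_gt hij)
    linarith
  have h01 := hgap 0 1 (by decide)
  have h12 := hgap 1 2 (by decide)
  have h23 := hgap 2 3 (by decide)
  linarith

/-- **At most three in a half-open half-plane.**  A finite set of planar unit vectors of `ℝ³`
(`u₂ = 0`) lying in the half-open upper half-plane `{u₁ > 0} ∪ {u₁ = 0, u₀ > 0}` with pairwise inner
products `≤ 1/2` has at most three elements. -/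
theorem card_le_three_of_halfOpen {F : Finset (EuclideanSpace ℝ (Fin 3))} (hn : ∀ u ∈ F, ‖u‖ = 1)
    (hz : ∀ u ∈ F, u 2 = 0) (hhalf : ∀ u ∈ F, 0 < u 1 ∨ (u 1 = 0 ∧ 0 < u 0))
    (hsep : ∀ u ∈ F, ∀ w ∈ F, u ≠ w → ⟪u, w⟫_ℝ ≤ 1 / 2) : F.card ≤ 3 := by
  classical
  by_contra hcard
  obtain ⟨F', hF', hcard4⟩ := Finset.exists_subset_card_eq (show 4 ≤ F.card by omega)
  -- the angle of each vector
  set θ : EuclideanSpace ℝ (Fin 3) → ℝ := fun u => Complex.arg ⟨u 0, u 1⟩ with hθdef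
  have hnormC : ∀ u ∈ F, ‖(⟨u 0, u 1⟩ : ℂ)‖ = 1 := by
    intro u hu
    have h1 : ‖u‖ ^ 2 = u 0 ^ 2 + u 1 ^ 2 + u 2 ^ 2 := by
      rw [EuclideanSpace.real_norm_sq_eq, Fin.sum_univ_three]
    rw [hn u hu, hz u hu] at h1
    have h2 : ‖(⟨u 0, u 1⟩ : ℂ)‖ ^ 2 = u 0 ^ 2 + u 1 ^ 2 := by
      rw [Complex.sq_norm, Complex.normSq_mk]; ring
    nlinarith [norm_nonneg (⟨u 0, u 1⟩ : ℂ)]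
  have hcos : ∀ u ∈ F, u 0 = cos (θ u) := by
    intro u hu
    have := Complex.norm_mul_cos_arg (⟨u 0, u 1⟩ : ℂ)
    rw [hnormC u hu, one_mul] at this
    exact this.symm
  have hsin : ∀ u ∈ F, u 1 = sin (θ u) := by
    intro u hu
    have := Complex.norm_mul_sin_arg (⟨u 0, u 1⟩ : ℂ)
    rw [hnormC u hu, one_mul] at this
    exact this.symm
  have hθlo : ∀ u ∈ F, 0 ≤ θ u := by
    intro u hu
    simp only [hθdef]
    rw [Complex.arg_nonneg_iff]
    rcases hhalf u hu with h | ⟨h, -⟩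
    · exact h.le
    · exact h.ge
  have hθhi : ∀ u ∈ F, θ u < π := by
    intro u hu
    simp only [hθdef]
    rw [Complex.arg_lt_pi_iff]
    rcases hhalf u hu with h | ⟨h, h'⟩
    · exact Or.inr (ne_of_gt h)
    · exact Or.inl h'.le
  have hinner : ∀ u ∈ F, ∀ w ∈ F, ⟪u, w⟫_ℝ = cos (θ u - θ w) := by
    intro u hu w hw
    have hin : ⟪u, w⟫_ℝ = u 0 * w 0 + u 1 * w 1 + u 2 * w 2 := by
      simp [PiLp.inner_apply, Fin.sum_univ_three, mul_comm]
    rw [hin, hz u hu, cos_sub, hcos u hu, hcos w hw, hsin u hu, hsin w hw]; ring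
  have hθinj : Set.InjOn θ ↑F := by
    intro u hu w hw huw
    by_contra hne
    have h := hsep u hu w hw hne
    rw [hinner u hu w hw, huw, sub_self, cos_zero] at h
    linarith
  -- sort the four angles of F'
  have hA : (F'.image θ).card = 4 := by
    rw [Finset.card_image_of_injOn (hθinj.mono hF'), hcard4]
  let emb := (F'.image θ).orderEmbOfFin hA
  have hmem : ∀ k, ∃ u ∈ F', θ u = emb k := by
    intro k
    have := (F'.image θ).orderEmbOfFin_mem hA k
    rw [Finset.mem_image] at this
    obtain ⟨u, hu, h⟩ := this
    exact ⟨u, hu, h⟩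
  choose v hvF' hv using hmem
  refine four_sorted_angles_false (fun k => emb k) emb.strictMono ?_ ?_ ?_
  · rw [← hv 0]; exact hθlo _ (hF' (hvF' 0))
  · rw [← hv 3]; exact hθhi _ (hF' (hvF' 3))
  · intro i j hij
    have hne : v i ≠ v j := by
      intro h
      apply hij
      apply emb.injective
      rw [← hv i, ← hv j, h]
    rw [← hv i, ← hv j, ← hinner _ (hF' (hvF' i)) _ (hF' (hvF' j))]
    exact hsep _ (hF' (hvF' i)) _ (hF' (hvF' j)) hne

/-! ### Planar unit-distance graphs are 3-degenerate -/

/-- **A coplanar set of points with pairwise distances `≥ 1` has a point with at most three points at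
distance exactly `1`.**  (Plane `{p : ⟪p − c, n⟫ = 0}`, `n ≠ 0`; take the point that is lowest in a frame
of the plane, lexicographically: its partners lie in a half-open half-plane.) -/
theorem exists_card_partners_le_three_of_coplanar (S : Finset (EuclideanSpace ℝ (Fin 3)))
    (hS : ∀ p ∈ S, ∀ q ∈ S, p ≠ q → 1 ≤ dist p q) (hne : S.Nonempty)
    (c n : EuclideanSpace ℝ (Fin 3)) (hn : n ≠ 0) (hplane : ∀ p ∈ S, ⟪p - c, n⟫_ℝ = 0) :
    ∃ q ∈ S, (S.filter fun x => dist q x = 1).card ≤ 3 := by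
  classical
  -- normalise the normal and rotate it to e₃
  set ν : EuclideanSpace ℝ (Fin 3) := ‖n‖⁻¹ • n with hνdef
  have hνn : ‖ν‖ = 1 := by
    rw [hνdef, norm_smul, norm_inv, norm_norm, inv_mul_cancel₀ (norm_ne_zero_iff.2 hn)]
  have hplane' : ∀ p ∈ S, ∀ q ∈ S, ⟪p - q, ν⟫_ℝ = 0 := by
    intro p hp q hq
    have e : p - q = (p - c) - (q - c) := by abel
    rw [hνdef, inner_smul_right, e, inner_sub_left, hplane p hp, hplane q hq]; simp
  obtain ⟨g, hg⟩ := exists_linearIsometryEquiv_apply_eq_single_two ν hνn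
  have hcoord2 : ∀ p ∈ S, ∀ q ∈ S, (g (p - q)) 2 = 0 := by
    intro p hp q hq
    have : (g (p - q)) 2 = ⟪p - q, ν⟫_ℝ := by
      rw [← g.inner_map_map (p - q) ν, hg]; simp [EuclideanSpace.inner_single_right]
    rw [this, hplane' p hp q hq]
  -- the lexicographically lowest point: minimise coordinate 1, then coordinate 0
  obtain ⟨q₁, hq₁, hmin₁⟩ := exists_min_image S (fun p => (g p) 1) hne
  set S₁ := S.filter fun p => (g p) 1 = (g q₁) 1 with hS₁
  have hS₁ne : S₁.Nonempty := ⟨q₁, by rw [hS₁, mem_filter]; exact ⟨hq₁, rfl⟩⟩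
  obtain ⟨q, hqS₁, hmin₀⟩ := exists_min_image S₁ (fun p => (g p) 0) hS₁ne
  have hq : q ∈ S := (mem_filter.1 hqS₁).1
  have hq1 : (g q) 1 = (g q₁) 1 := (mem_filter.1 hqS₁).2
  refine ⟨q, hq, ?_⟩
  -- the partner directions
  set T := S.filter fun x => dist q x = 1 with hT
  set F := T.image fun x => g (x - q) with hF
  have hinj : Set.InjOn (fun x => g (x - q)) ↑T := by
    intro x _ y _ hxy
    have : x - q = y - q := g.injective hxy
    exact sub_left_injective this
  have hcardF : F.card = T.card := card_image_of_injOn hinj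
  rw [← hcardF]
  have hTmem : ∀ x ∈ T, x ∈ S ∧ dist q x = 1 := fun x hx => mem_filter.1 hx
  apply card_le_three_of_halfOpen
  · intro u hu
    obtain ⟨x, hx, rfl⟩ := mem_image.1 hu
    rw [g.norm_map, ← dist_eq_norm, dist_comm]; exact (hTmem x hx).2
  · intro u hu
    obtain ⟨x, hx, rfl⟩ := mem_image.1 hu
    exact hcoord2 x (hTmem x hx).1 q hq
  · intro u hu
    obtain ⟨x, hx, rfl⟩ := mem_image.1 hu
    have hxS := (hTmem x hx).1
    have e1 : (g (x - q)) 1 = (g x) 1 - (g q) 1 := by rw [map_sub]; rfl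
    have e0 : (g (x - q)) 0 = (g x) 0 - (g q) 0 := by rw [map_sub]; rfl
    have h1 : (g q) 1 ≤ (g x) 1 := by rw [hq1]; exact hmin₁ x hxS
    rcases h1.lt_or_eq with hlt | heq
    · left; rw [e1]; linarith
    · right
      have hxS₁ : x ∈ S₁ := by rw [hS₁, mem_filter]; exact ⟨hxS, by rw [← heq, hq1]⟩
      have h0 : (g q) 0 ≤ (g x) 0 := hmin₀ x hxS₁
      refine ⟨by rw [e1, heq]; ring, ?_⟩
      rw [e0]
      rcases h0.lt_or_eq with hlt0 | heq0
      · linarith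
      · -- then g (x − q) = 0, contradicting dist q x = 1
        exfalso
        have hzero : g (x - q) = 0 := by
          ext i
          fin_cases i
          · show (g (x - q)) 0 = 0
            rw [e0, heq0]; ring
          · show (g (x - q)) 1 = 0
            rw [e1, heq]; ring
          · show (g (x - q)) 2 = 0
            exact hcoord2 x hxS q hq
        have : ‖g (x - q)‖ = 1 := by rw [g.norm_map, ← dist_eq_norm, dist_comm]; exact (hTmem x hx).2
        rw [hzero, norm_zero] at this
        exact zero_ne_one this
  · intro u hu w hw huw
    obtain ⟨x, hx, rfl⟩ := mem_image.1 hu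
    obtain ⟨y, hy, rfl⟩ := mem_image.1 hw
    have hxy : x ≠ y := fun e => huw (by rw [e])
    rw [g.inner_map_map]
    have h1 := hS x (hTmem x hx).1 y (hTmem y hy).1 hxy
    rw [dist_eq_norm] at h1
    have hux : ‖x - q‖ = 1 := by rw [← dist_eq_norm, dist_comm]; exact (hTmem x hx).2
    have huy : ‖y - q‖ = 1 := by rw [← dist_eq_norm, dist_comm]; exact (hTmem y hy).2
    have e : x - y = (x - q) - (y - q) := by abel
    have h2 : 1 ≤ ‖(x - q) - (y - q)‖ ^ 2 := by rw [← e]; nlinarith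
    rw [norm_sub_sq_real, hux, huy] at h2
    linarith

/-- **Coplanar ⇒ contact-3-degenerate**: every nonempty subset of a coplanar set with pairwise
distances `≥ 1` has a point with at most three partners inside the subset. -/
theorem threeDegenerate_of_coplanar (O : Finset (EuclideanSpace ℝ (Fin 3)))
    (hO : ∀ p ∈ O, ∀ q ∈ O, p ≠ q → 1 ≤ dist p q)
    (c n : EuclideanSpace ℝ (Fin 3)) (hn : n ≠ 0) (hplane : ∀ p ∈ O, ⟪p - c, n⟫_ℝ = 0) :
    ∀ S ⊆ O, S.Nonempty → ∃ q ∈ S, (S.filter fun x => dist q x = 1).card ≤ 3 :=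
  fun S hS hne => exists_card_partners_le_three_of_coplanar S
    (fun p hp q hq hpq => hO p (hS hp) q (hS hq) hpq) hne c n hn (fun p hp => hplane p (hS hp))

/-! ### The rung, by name -/

/-- **The atom for films whose off-lattice part is coplanar** (all normals `ν`, `R = 1`, `C = 0`;
rung of the registered `stub_adhesion` on stmt-Ventures-19144).  If the off-lattice film balls lie in
one affine plane `{p : ⟪p − c, n⟫ = 0}` (`n ≠ 0`; any position relative to the facet), then
`#cross(P, X \ P) ≤ contactDeficiency (X \ P)`. -/
theorem coplanarOffLattice_adhesion :
    ∃ R C : ℝ, 1 ≤ R ∧ ∀ ν : EuclideanSpace ℝ (Fin 3), ‖ν‖ = 1 → ∀ ρ : ℝ, R ≤ ρ →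
      ∀ X P : Finset (EuclideanSpace ℝ (Fin 3)),
      (∀ p ∈ X, ∀ q ∈ X, p ≠ q → 1 ≤ dist p q) → P ⊆ X →
      (∀ p, p ∈ P ↔ (p ∈ Literature.MathematicalPhysics.StatisticalMechanics.fccStacking 1
        (Real.sqrt (2 / 3)) ∧ -(2 * R) ≤ ⟪p, ν⟫_ℝ ∧ ⟪p, ν⟫_ℝ ≤ -R ∧ ‖p‖ ^ 2 - ⟪p, ν⟫_ℝ ^ 2 ≤ ρ ^ 2)) →
      (∃ c n : EuclideanSpace ℝ (Fin 3), n ≠ 0 ∧ ∀ x ∈ X \ P,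
        x ∉ Literature.MathematicalPhysics.StatisticalMechanics.fccStacking 1 (Real.sqrt (2 / 3)) →
          ⟪x - c, n⟫_ℝ = 0) →
      ((((P ×ˢ (X \ P)).filter fun pq => dist pq.1 pq.2 = 1).card : ℕ) : ℝ) ≤
        Literature.MathematicalPhysics.StatisticalMechanics.contactDeficiency (X \ P) + C * ρ := by
  classical
  obtain ⟨R, C, hR, h⟩ := offRegistryThreeDegenerate_adhesion
  refine ⟨R, C, hR, fun ν hν ρ hρ X P hX hPX hP hcop => h ν hν ρ hρ X P hX hPX hP ?_⟩
  obtain ⟨c, n, hn, hplane⟩ := hcop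
  intro S hS hoff hne
  refine exists_card_partners_le_three_of_coplanar S ?_ hne c n hn ?_
  · intro p hp q hq hpq
    exact hX p (sdiff_subset (hS hp)) q (sdiff_subset (hS hq)) hpq
  · intro p hp
    exact hplane p (hS hp) (hoff p hp)

/-- **Several planar islands.**  The same conclusion when every off-lattice film ball `x` carries a
plane `(c x, n x)` (`n x ≠ 0`, `⟪x − c x, n x⟫ = 0`) and TOUCHING off-lattice balls carry the same
plane (islands on different terraces or at different tilts that do not touch one another). -/
theorem planarComponents_adhesion :
    ∃ R C : ℝ, 1 ≤ R ∧ ∀ ν : EuclideanSpace ℝ (Fin 3), ‖ν‖ = 1 → ∀ ρ : ℝ, R ≤ ρ →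
      ∀ X P : Finset (EuclideanSpace ℝ (Fin 3)),
      (∀ p ∈ X, ∀ q ∈ X, p ≠ q → 1 ≤ dist p q) → P ⊆ X →
      (∀ p, p ∈ P ↔ (p ∈ Literature.MathematicalPhysics.StatisticalMechanics.fccStacking 1
        (Real.sqrt (2 / 3)) ∧ -(2 * R) ≤ ⟪p, ν⟫_ℝ ∧ ⟪p, ν⟫_ℝ ≤ -R ∧ ‖p‖ ^ 2 - ⟪p, ν⟫_ℝ ^ 2 ≤ ρ ^ 2)) →
      (∃ c n : EuclideanSpace ℝ (Fin 3) → EuclideanSpace ℝ (Fin 3),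
        (∀ x ∈ X \ P,
          x ∉ Literature.MathematicalPhysics.StatisticalMechanics.fccStacking 1 (Real.sqrt (2 / 3)) →
            n x ≠ 0 ∧ ⟪x - c x, n x⟫_ℝ = 0) ∧
        (∀ x ∈ X \ P, ∀ y ∈ X \ P,
          x ∉ Literature.MathematicalPhysics.StatisticalMechanics.fccStacking 1 (Real.sqrt (2 / 3)) →
          y ∉ Literature.MathematicalPhysics.StatisticalMechanics.fccStacking 1 (Real.sqrt (2 / 3)) →
            dist x y = 1 → c x = c y ∧ n x = n y)) →
      ((((P ×ˢ (X \ P)).filter fun pq => dist pq.1 pq.2 = 1).card : ℕ) : ℝ) ≤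
        Literature.MathematicalPhysics.StatisticalMechanics.contactDeficiency (X \ P) + C * ρ := by
  classical
  obtain ⟨R, C, hR, h⟩ := offRegistryThreeDegenerate_adhesion
  refine ⟨R, C, hR, fun ν hν ρ hρ X P hX hPX hP hlab => h ν hν ρ hρ X P hX hPX hP ?_⟩
  obtain ⟨c, n, hcn, hsame⟩ := hlab
  intro S hS hoff hne
  -- work inside the island of any ball of S
  obtain ⟨x₀, hx₀⟩ := hne
  set S₀ := S.filter fun x => c x = c x₀ ∧ n x = n x₀ with hS₀
  have hS₀S : S₀ ⊆ S := filter_subset _ _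
  have hS₀ne : S₀.Nonempty := ⟨x₀, by rw [hS₀, mem_filter]; exact ⟨hx₀, rfl, rfl⟩⟩
  have hn₀ : n x₀ ≠ 0 := (hcn x₀ (hS hx₀) (hoff x₀ hx₀)).1
  obtain ⟨q, hqS₀, hq⟩ := exists_card_partners_le_three_of_coplanar S₀
    (fun p hp q hq hpq => hX p (sdiff_subset (hS (hS₀S hp))) q (sdiff_subset (hS (hS₀S hq))) hpq)
    hS₀ne (c x₀) (n x₀) hn₀ (by
      intro p hp
      obtain ⟨hpS, hpc, hpn⟩ := mem_filter.1 hp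
      have := (hcn p (hS hpS) (hoff p hpS)).2
      rwa [hpc, hpn] at this)
  refine ⟨q, hS₀S hqS₀, ?_⟩
  -- every partner of q inside S lies in q's island
  have hqc : c q = c x₀ ∧ n q = n x₀ := (mem_filter.1 hqS₀).2
  have hsub : (S.filter fun x => dist q x = 1) ⊆ S₀.filter fun x => dist q x = 1 := by
    intro x hx
    obtain ⟨hxS, hqx⟩ := mem_filter.1 hx
    have hlab := hsame q (hS (hS₀S hqS₀)) x (hS hxS) (hoff q (hS₀S hqS₀)) (hoff x hxS) hqx
    rw [mem_filter, hS₀, mem_filter]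
    exact ⟨⟨hxS, by rw [← hlab.1, hqc.1], by rw [← hlab.2, hqc.2]⟩, hqx⟩
  exact (card_le_card hsub).trans hq

end Summit.Ventures.Crystal3D.Theorems

end
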